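import Summits.NavierStokesRegularity.NavierStokesRegularity.Theorems.PalasekTowerBreakdownEpisodeBaseTMechanismFreeRun
import Summits.NavierStokesRegularity.NavierStokesRegularity.Theorems.HeredityFromTwoT.Negative.HeredityFromTwoTFalseOfNoSwirlRungT
import Summits.NavierStokesRegularity.NavierStokesRegularity.Theorems.PalasekTowerBreakdownEpisodeBaseTSterileDoorOfCarrier
import Summits.NavierStokesRegularity.FluidComputer.PalasekTowerSterileCarrierAt
import Literature.Analysis.FluidPDE.AxisymmetricEuler

/-!
# DOOR MIRROR — the swirl-free decider re-typed to the DOOR BOX (READING 2 of record), and what it decides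

Cell `ns-blowup`, seat `cstrat-stmt-NavierStokesRegularity-19179` (g3; crux-strategist of route `PalasekTowerBreakdown`
rev 19; crux of record stmt-NavierStokesRegularity-20303 `EpisodeBaseT`; negation-lens targets stmt-…-20304 `HeredityAtOneT` /
-20305 `HeredityFromTwoT`). LABEL: E–C typing (crux-chain SKELETON: named open `Prop`s = stubs, `sorry` ONLY inside
`stub_*`, sorry-free compositions). WHAT THIS IS NOT: not Navier–Stokes evidence — no free run, design or stage is
constructed; `EpisodeBaseT` and `¬ (HeredityAtOneT ∧ HeredityFromTwoT)` appear only as conclusions of conditionals.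

## The point (DIRECTOR-NS #74 (3)(A)(ii): «whether T1 can be re-typed to the door box (T1′) with T2's shadow lemma re-proved»)

The line «robustmirror» (`Lines/robustmirror.lean` v7) asks its ONE stub T1 `SlackFacesT` for the faces F0–F7 of an
UNFORCED sterile free run at BOTH levels (early anchor F0, transversal `Y₀`-crossing F1 at `τ₀`, far field F2, level-0
gradient/core F6₀/F7₀, level-1 speed/gradient/core F3/F6₁/F7₁, caps F4/F5). Tranche 0 (MODEL, STATUS l.10255) missed it
STRUCTURALLY on the level-0 side (F2: ring expansion; F6₀ vs F3: one-scale speed–gradient trade-off), while the best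
members reach 0.94 / 0.90 / 0.89 of the binding LEVEL-1 gradient face of the DOOR BOX. The door box = the hypothesis
list of the landed kernel door `Theorems.palasekTowerBreakdown_episodeBaseT_of_mechanism_freeRun` (p540639, ecbridge-3):
compactly supported smooth divergence-free datum of speed `< Y₀`, ONE classical finite-energy free run on
`[1, τfirstAt tuned]` under the cap `(5/3)Y₁ − η`, and at `τfirstAt tuned`, inside the support ball, speed `≥ Y₁ + η`,
gradient `≥ A₁ + η`, an `N₁`-core loop of circulation `≥ N₁^{β−2} + η` — NO level-0 face, NO anchor, NO far field (the
level-0 rung is supplied in the kernel by the TAME CARRIER of the germ host, `Germ.mechanismDoorAt_of_boxNumerics`).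

THIS FILE types T1′ and answers the director's question in the kernel:

* T1′ = `SterileDoorBoxT` (stub `stub_sterile_doorboxT`, a 2-D axisymmetric computation / certificate): SOME axisymmetric
  swirl-free `W` meets the door box at the tuned rates. **`EpisodeBaseT_of₁ : SterileDoorBoxT → EpisodeBaseT` is
  IMMEDIATE** (the landed door; sterility unused) — the constructive half of T1 re-types to the door box with NO shadow
  lemma at all.
* The NEGATION half does NOT re-type for free: the door's registering design is FORCED (zero datum, germ force of the
  composite «tame carrier ⊕ translated W» on `[0, 1]`, fade on `[1, 1 + ε]`), so «robustmirror»'s cascade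
  (`RobustNoSwirlRungAtOneT`: UNFORCED registration, `S.f = 0`) does not apply, and the composite is not swirl-free unless
  the carrier is coaxial. What replaces T2 is ONE kernel lemma, typed here as the second stub
  D2 = `SterileMechanismDoorT` (stub `stub_sterile_doorT`): **the mechanism door can be walked STERILE** — for an
  axisymmetric swirl-free `W` meeting the box, the registering tuned design can be chosen with `NoSwirlDesign` (zero datum;
  force axisymmetric swirl-free at all `t ≥ 0`): an axisymmetric swirl-free tame carrier (strict slot `LevelZeroDataAt`,
  `L³`-small, free run under the cap), superposition along the AXIS (`LevelZeroDataAt.exists_superposed_freeRun` allows any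
  translation `c` with `‖c‖ ≥ r₀`), and `SO(2) × reflection`-equivariance of the germ force (Leray projection and the NS
  residual commute with isometries fixing the axis). Then K201's FORCED swirl-free stratum does the rest BY NAME:
  `NoSwirlRungAtOneT := NoSwirlRungGAt tuned 1` is inhabited, and `not_noSwirlRungAtOneT_of_heredity_pair` (global
  regularity of forced axisymmetric swirl-free designs = tree theorem `forcedNoSwirlGlobal_holds`, uniqueness along the
  register) refutes the PAIR `HeredityAtOneT ∧ HeredityFromTwoT`.
* D2 IS CUT IN TWO (v3, after ecbridge-3's `PalasekTowerGermHostIsometry` + `PalasekTowerGermHostFreeRunStageAt`,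
  ACCEPTED 2026-08-27): D2a = `SterileSmallCarrierT` (an explicit CONSTRUCTION, no dynamics; **A THEOREM since v5**:
  `sterileSmallCarrierT`, by name over fc-prover-2 g11's `Germ.exists_sterile_levelZeroDataAt_small` — blob + coaxial POLOIDAL
  `ringPusher`, strict-anchor sign `exists_ringPusher_anchor_integral_pos`): axisymmetric swirl-free strict-slot carriers at `tuned` of every `L³` size — the sterile twin of
  `Germ.exists_levelZeroDataAt_small` (the blob `tinyProfileAt` is already axisymmetric swirl-free, even and flat, anchor
  value `0`; the pure-swirl `faintPusher` is replaced by a COAXIAL POLOIDAL pusher whose strict anchor test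
  `0 < ⟪U x, accel 1 U x⟫` at the argmax is the sign of one far-field moment, odd in the side of the placement —
  `GermHostFarFieldSign.anchor_test_iff_fderiv3`); D2b = `sterileMechanismDoorT_of_smallCarrierT : SterileSmallCarrierT →
  SterileMechanismDoorT` — **DISCHARGED BY NAME since v4** by ecbridge-3's landed
  `Theorems.palasekTowerBreakdown_sterileMechanismDoorT_of_sterileSmallCarrierT` (p562247,
  `Theorems/PalasekTowerBreakdownEpisodeBaseTSterileDoorOfCarrier.lean`, same binders verbatim) (PLUMBING BY NAME: Kato tame run `exists_classical_run_norm_le_two_mul_Icc` under the cap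
  (`tuned_sep`, `margin_le_third_at`), superposition along the axis `LevelZeroDataAt.exists_superposed_freeRun` (any `c`
  with `‖c‖ ≥ r₀`; take `c ∈ ℝe₃`, so the composite is axisymmetric swirl-free), the schedule-exposed free-run door
  `LevelZeroDataAt.exists_lineGerm_stageOne_of_freeRun`, sterility of the germ design
  `LineGermDataAt.schedule_axisym_noSwirl`, pins/rigidity/quietness `LineGermDataAt.schedule_facts`).
* Bottom lines (v5): **D2 `sterileMechanismDoorT : SterileMechanismDoorT` IS A THEOREM** (D2a `sterileSmallCarrierT` +
  D2b `sterileMechanismDoorT_of_smallCarrierT`, both by name), so the sterile road of the line has ONE open stub, T1′: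
  `EpisodeBaseT_of₁ : SterileDoorBoxT → EpisodeBaseT` (door only; the registered composition),
  `noSwirlRungAtOneT_of₁ : SterileDoorBoxT → NoSwirlRungAtOneT`,
  **`door_mirror_decides₁ : SterileDoorBoxT → EpisodeBaseT ∧ ¬ (HeredityAtOneT ∧ HeredityFromTwoT)`** — a sterile door
  certificate ALONE decides the crux of record AND the heredity pair of record in the kernel; the two-hypothesis forms
  `not_heredityPairT_of`, `door_mirror_decides`, `door_mirror_decides_of_carrier`, `EpisodeBaseT_of_carrier` are kept.
  STUB CENSUS (v5): `stub_sterile_doorboxT` (T1′, the 2-D sterile computation / certificate — MODEL probe = the STERILE-DOOR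
  test PREREG-0b) ONLY. History: v1 T1′ + D2; v2 + D2′; v3 D2 = D2a + D2b; v4 D2b discharged (ecbridge-3 p562247); v5 D2a
  discharged (fc-prover-2's sterile carrier), D2′ un-stubbed.
* D2′ = `GlobalDoorDesignT` (named `Prop`, no stub since v5 — the ALTERNATIVE road, not load-bearing; kernel analysis): the mechanism door
  walked with a GLOBALLY SOLVABLE design — for an axisymmetric swirl-free `W` meeting the box, the registering tuned design
  (zero datum, germ force + fade) can be chosen together with a GLOBAL finite-energy classical solution of its forced problem:
  carrier `δ`-small in `L³` chosen AFTER `W` (`Germ.exists_levelZeroDataAt_small`), composite free run global by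
  Gallagher–Iftimie–Planchon openness around the sterile run (tree S2 `exists_L3_ball_global_classical_of_axisym_noSwirl`,
  p542725; translation moved onto the carrier), fade small in `L³` against the GIP radius along the composite trajectory
  (`exists_L3_ball_global_classical_of_hasGlobalKatoSolution` + `hasGlobalKatoSolution_of_global_classical`). Then the
  cap-free, symmetry-free GLOBAL-DESIGN LEVER of K201 (`HeredityFromGAt.false_of_global_classical`, Tao Cor. 11.4) refutes
  the pair: `not_heredityPairT_of' : SterileDoorBoxT → GlobalDoorDesignT → ¬ (HeredityAtOneT ∧ HeredityFromTwoT)`. D2′ needs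
  NO coaxial carrier and is the stub-set that extends to the SHELF twins (card).
* NOT typed here (recorded in the card): the ROBUST/SHELF branch (door box with slack is open in `W`; live `W′` register
  through the door with a design whose globality needs Gallagher–Iftimie–Planchon around the translated sterile run and a
  `δ`-small carrier — the «small-carrier door», an alternative D2′ that needs no coaxial carrier but an `L³` fade estimate).

References: S. Palasek, arXiv:2605.13827 §4 [cite: Palasek2026ElementaryModel, §4]; T. Tao, Anal. PDE 6 (2013) Thm 5.4
[cite: Tao2011, Thm. 5.4 (ii)+(iv)]; P. G. Lemarié-Rieusset (2016) Thm 10.4 [cite: LemarieRieusset2016, Thm 10.4 (p. 285)];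
T. Kato, Math. Z. 187 (1984) [cite: Kato1984, Thm. 2–4]; G. Koch, N. Nadirashvili, G. Seregin, V. Šverák, Acta Math. 203
(2009) §1 (1.5) [cite: KNSS2009, §1 (1.5)].
-/

noncomputable section

namespace Summit.NavierStokesRegularity.NavierStokesRegularity.Cruxes.EpisodeBaseT.DoorMirror

open Set MeasureTheory Filter Topology Function Metric
open scoped ENNReal ContDiff NNReal
open Literature.Analysis.FluidPDE
open Summit.NavierStokesRegularity.FluidComputer
open Summit.NavierStokesRegularity.FluidComputer.PalasekTowerClayBridge
open Summit.NavierStokesRegularity.HeredityFromTwoTNoSwirl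
open Summit.NavierStokesRegularity.NavierStokesRegularity.Theses

/-! ## §1 The statements -/

/-- **T1′ — THE STERILE DOOR BOX at the tuned rates** (stub; a 2-D axisymmetric swirl-free computation / certificate;
READING 2 of record, DIRECTOR-NS #74 (1)): some AXISYMMETRIC SWIRL-FREE smooth divergence-free datum `W` with
`tsupport W ⊆ B̄(0, ρ)` (`ρ ≥ 0`) and speed `< Y₀(tuned)` has ONE classical finite-energy FREE run `(v, q)` (`ν = 1`) on
`[1, τfirstAt tuned]` from `v 1 = W` which, for some margin `η > 0`, stays `≤ (5/3) Y₁(tuned) − η` on the window and shows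
at `τfirstAt tuned`, inside `‖x‖ ≤ ρ`: speed `≥ Y₁ + η`, gradient `≥ A₁ + η`, and an `N₁`-core loop (`C¹`, closed, in a
`1/N₁`-ball, speed `≤ 8π/N₁`) of circulation `≥ N₁^{β−2} + η` — verbatim the hypothesis list of
`Theorems.palasekTowerBreakdown_episodeBaseT_of_mechanism_freeRun`, plus sterility of `W`. Dictionary for engines (free NS
scaling, ecbridge-3 STATUS l.10205 / K227): window `169.85·α²` after the release, speed `≥ 2.0705/α`, `‖∇v‖_op ≥ 3.482/α²`,
loop circulation `≥ 1.231` within radius `0.5946·α`, cap `≤ 3.45/α`, with `α · sup‖W‖ < 1`.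
[cite: Palasek2026ElementaryModel, §4] -/
def SterileDoorBoxT : Prop :=
  ∃ (W : EuclideanSpace ℝ (Fin 3) → EuclideanSpace ℝ (Fin 3)) (ρ : ℝ)
    (v : ℝ → EuclideanSpace ℝ (Fin 3) → EuclideanSpace ℝ (Fin 3)) (q : ℝ → EuclideanSpace ℝ (Fin 3) → ℝ) (η : ℝ),
    IsAxisymmetric W ∧ HasNoSwirl W ∧
    ContDiff ℝ ∞ W ∧ VectorCalculus.IsDivFree W ∧ tsupport W ⊆ closedBall 0 ρ ∧
    (∀ x, ‖W x‖ < TowerRates.tuned.Y 0) ∧ 0 ≤ ρ ∧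
    IsClassicalNSSolutionOn (Icc 1 (Host.τfirstAt TowerRates.tuned)) 1 0 v q ∧ v 1 = W ∧
    (∃ C : ℝ≥0∞, C < ⊤ ∧ ∀ t ∈ Icc (1 : ℝ) (Host.τfirstAt TowerRates.tuned), ∫⁻ x, ‖v t x‖ₑ ^ 2 ≤ C) ∧
    0 < η ∧
    (∀ t ∈ Icc (1 : ℝ) (Host.τfirstAt TowerRates.tuned), ∀ x, ‖v t x‖ ≤ 5 / 3 * TowerRates.tuned.Y 1 - η) ∧
    (∃ x, ‖x‖ ≤ ρ ∧ TowerRates.tuned.Y 1 + η ≤ ‖v (Host.τfirstAt TowerRates.tuned) x‖) ∧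
    (∃ x, ‖x‖ ≤ ρ ∧ TowerRates.tuned.A 1 + η ≤ ‖fderiv ℝ (v (Host.τfirstAt TowerRates.tuned)) x‖) ∧
    (∃ (x : EuclideanSpace ℝ (Fin 3)) (γ : ℝ → EuclideanSpace ℝ (Fin 3)),
      ‖x‖ ≤ ρ ∧ ContDiff ℝ 1 γ ∧ γ 0 = γ 1 ∧
      (∀ s ∈ Icc (0 : ℝ) 1, γ s ∈ closedBall x (1 / TowerRates.tuned.N 1)) ∧
      (∀ s ∈ Icc (0 : ℝ) 1, ‖deriv γ s‖ ≤ 8 * Real.pi / TowerRates.tuned.N 1) ∧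
      TowerRates.tuned.N 1 ^ (TowerRates.tuned.β - 2) + η ≤ circulation (v (Host.τfirstAt TowerRates.tuned)) γ)

/-- **D2 — THE STERILE MECHANISM DOOR at the tuned rates** (stub; kernel analysis, no computation): the mechanism door
walked inside the swirl-free stratum — for every AXISYMMETRIC SWIRL-FREE `W` meeting the door box (same binders as
`StrainDoor.MechanismDoorAt tuned`), the swirl-free witness class `NoSwirlRungAtOneT` (K201: a pinned rigid quiet tuned
design with axisymmetric swirl-free datum AND force carrying a registered level-`1` stage) is inhabited. Intended proof:
an axisymmetric swirl-free TAME CARRIER in the strict slot (`Germ.LevelZeroDataAt`, `L³`-small, free run under the cap —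
the coaxial twin of `Germ.exists_levelZeroDataAt_tame_freeRun_cap`), superposition ALONG THE AXIS
(`Germ.LevelZeroDataAt.exists_superposed_freeRun` admits every translation of length `≥ r₀`), and equivariance of the germ
force under the isometries fixing the axis; the germ schedule has zero datum. [cite: Palasek2026ElementaryModel, §4]
[cite: Kato1984, Thm. 2–4] [cite: KNSS2009, §1 (1.5)] -/
def SterileMechanismDoorT : Prop :=
  ∀ ⦃W : EuclideanSpace ℝ (Fin 3) → EuclideanSpace ℝ (Fin 3)⦄ ⦃ρ : ℝ⦄,
    IsAxisymmetric W → HasNoSwirl W →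
    ContDiff ℝ ∞ W → VectorCalculus.IsDivFree W → tsupport W ⊆ closedBall 0 ρ →
    (∀ x, ‖W x‖ < TowerRates.tuned.Y 0) → 0 ≤ ρ →
    ∀ ⦃v : ℝ → EuclideanSpace ℝ (Fin 3) → EuclideanSpace ℝ (Fin 3)⦄ ⦃q : ℝ → EuclideanSpace ℝ (Fin 3) → ℝ⦄,
      IsClassicalNSSolutionOn (Icc 1 (Host.τfirstAt TowerRates.tuned)) 1 0 v q → v 1 = W →
      (∃ C : ℝ≥0∞, C < ⊤ ∧ ∀ t ∈ Icc (1 : ℝ) (Host.τfirstAt TowerRates.tuned), ∫⁻ x, ‖v t x‖ₑ ^ 2 ≤ C) →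
      ∀ ⦃η : ℝ⦄, 0 < η →
        (∀ t ∈ Icc (1 : ℝ) (Host.τfirstAt TowerRates.tuned), ∀ x, ‖v t x‖ ≤ 5 / 3 * TowerRates.tuned.Y 1 - η) →
        (∃ x, ‖x‖ ≤ ρ ∧ TowerRates.tuned.Y 1 + η ≤ ‖v (Host.τfirstAt TowerRates.tuned) x‖) →
        (∃ x, ‖x‖ ≤ ρ ∧ TowerRates.tuned.A 1 + η ≤ ‖fderiv ℝ (v (Host.τfirstAt TowerRates.tuned)) x‖) →
        (∃ (x : EuclideanSpace ℝ (Fin 3)) (γ : ℝ → EuclideanSpace ℝ (Fin 3)),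
          ‖x‖ ≤ ρ ∧ ContDiff ℝ 1 γ ∧ γ 0 = γ 1 ∧
          (∀ s ∈ Icc (0 : ℝ) 1, γ s ∈ closedBall x (1 / TowerRates.tuned.N 1)) ∧
          (∀ s ∈ Icc (0 : ℝ) 1, ‖deriv γ s‖ ≤ 8 * Real.pi / TowerRates.tuned.N 1) ∧
          TowerRates.tuned.N 1 ^ (TowerRates.tuned.β - 2) + η ≤ circulation (v (Host.τfirstAt TowerRates.tuned)) γ) →
        NoSwirlRungAtOneT

/-- **D2′ — THE GLOBALLY SOLVABLE MECHANISM DOOR at the tuned rates** (stub; kernel analysis, no computation; the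
ALTERNATIVE to D2): for every AXISYMMETRIC SWIRL-FREE `W` meeting the door box, some pinned rigid quiet tuned design carrying a
registered level-`1` stage has a GLOBAL finite-energy classical solution of its forced problem `(S.u₀, S.f)`. Intended proof:
the door of record with the tame carrier chosen `δ`-small in `L³` after `W` and the fade short, so that the design's solution
(germ on `[0,1]`, fade on `[1,1+ε]`, then a free run) stays inside the Gallagher–Iftimie–Planchon ball of the global sterile
run from `W` (tree S2, p542725) — no symmetry of the design is needed. [cite: Palasek2026ElementaryModel, §4]
[cite: Tao2011, Cor. 11.4] [cite: LemarieRieusset2016, Thm 10.4 (p. 285)] -/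
def GlobalDoorDesignT : Prop :=
  ∀ ⦃W : EuclideanSpace ℝ (Fin 3) → EuclideanSpace ℝ (Fin 3)⦄ ⦃ρ : ℝ⦄,
    IsAxisymmetric W → HasNoSwirl W →
    ContDiff ℝ ∞ W → VectorCalculus.IsDivFree W → tsupport W ⊆ closedBall 0 ρ →
    (∀ x, ‖W x‖ < TowerRates.tuned.Y 0) → 0 ≤ ρ →
    ∀ ⦃v : ℝ → EuclideanSpace ℝ (Fin 3) → EuclideanSpace ℝ (Fin 3)⦄ ⦃q : ℝ → EuclideanSpace ℝ (Fin 3) → ℝ⦄,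
      IsClassicalNSSolutionOn (Icc 1 (Host.τfirstAt TowerRates.tuned)) 1 0 v q → v 1 = W →
      (∃ C : ℝ≥0∞, C < ⊤ ∧ ∀ t ∈ Icc (1 : ℝ) (Host.τfirstAt TowerRates.tuned), ∫⁻ x, ‖v t x‖ₑ ^ 2 ≤ C) →
      ∀ ⦃η : ℝ⦄, 0 < η →
        (∀ t ∈ Icc (1 : ℝ) (Host.τfirstAt TowerRates.tuned), ∀ x, ‖v t x‖ ≤ 5 / 3 * TowerRates.tuned.Y 1 - η) →
        (∃ x, ‖x‖ ≤ ρ ∧ TowerRates.tuned.Y 1 + η ≤ ‖v (Host.τfirstAt TowerRates.tuned) x‖) →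
        (∃ x, ‖x‖ ≤ ρ ∧ TowerRates.tuned.A 1 + η ≤ ‖fderiv ℝ (v (Host.τfirstAt TowerRates.tuned)) x‖) →
        (∃ (x : EuclideanSpace ℝ (Fin 3)) (γ : ℝ → EuclideanSpace ℝ (Fin 3)),
          ‖x‖ ≤ ρ ∧ ContDiff ℝ 1 γ ∧ γ 0 = γ 1 ∧
          (∀ s ∈ Icc (0 : ℝ) 1, γ s ∈ closedBall x (1 / TowerRates.tuned.N 1)) ∧
          (∀ s ∈ Icc (0 : ℝ) 1, ‖deriv γ s‖ ≤ 8 * Real.pi / TowerRates.tuned.N 1) ∧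
          TowerRates.tuned.N 1 ^ (TowerRates.tuned.β - 2) + η ≤ circulation (v (Host.τfirstAt TowerRates.tuned)) γ) →
        ∃ (S : Schedule TowerRates.tuned) (_ : Stage 1 TowerRates.tuned S (Margins.routeG TowerRates.tuned) 1)
          (u : ℝ → EuclideanSpace ℝ (Fin 3) → EuclideanSpace ℝ (Fin 3)) (p : ℝ → EuclideanSpace ℝ (Fin 3) → ℝ),
          S.Pins 8 (6 / 5) ∧ S.Rigid ∧ S.Quiet ∧
            IsClassicalNSSolutionOn (Ici 0) 1 S.f u p ∧ u 0 = S.u₀ ∧ HasBoundedEnergy u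

/-- **D2a — STERILE STRICT-SLOT CARRIERS OF EVERY `L³` SIZE at the tuned rates** (stub; an explicit construction, no
Navier–Stokes dynamics): for every `δ > 0` an AXISYMMETRIC SWIRL-FREE profile filling the strict slot at `tuned` inside
radius `7` (`Germ.LevelZeroDataAt`: smooth, confined, divergence-free, ceiling `Y₀` attained, level-`0` gradient and core,
STRICT anchor `0 < ⟪U x, accel 1 U x⟫` wherever `‖U x‖ = Y₀`) with `‖U‖_{L³} ≤ δ` — the sterile twin of
`Germ.exists_levelZeroDataAt_small` (whose carrier `tameCarrierAt R a λ = tinyProfileAt R a + faintPusher λ′` has a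
pure-swirl pusher). [cite: Palasek2026ElementaryModel, §3.3] -/
def SterileSmallCarrierT : Prop :=
  ∀ δ : ℝ, 0 < δ →
    ∃ U : EuclideanSpace ℝ (Fin 3) → EuclideanSpace ℝ (Fin 3),
      IsAxisymmetric U ∧ HasNoSwirl U ∧ Germ.LevelZeroDataAt TowerRates.tuned U 7 ∧ (eLpNorm U 3 volume).toReal ≤ δ

/-! ## §2 The stubs (`sorry` only here) -/

/-- **STUB T1′** — the sterile door box (2-D computation / certificate; the STERILE-DOOR test of DIRECTOR-NS #74/#75 is
its MODEL probe). [cite: Palasek2026ElementaryModel, §4] -/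
theorem stub_sterile_doorboxT : SterileDoorBoxT := by
  sorry

/-- **D2a — NO LONGER A STUB (v5): DISCHARGED BY NAME** by fc-prover-2 g11's landed sterile strict-slot carrier
`Germ.sterileCarrierAt R a μ = tinyProfileAt R a + μ • ringPusher ringThin` (coaxial POLOIDAL ring pusher `ringPusher`,
p562266; SOS density bound p563545; strict-anchor sign `exists_ringPusher_anchor_integral_pos`, p564714; carrier file
`FluidComputer/PalasekTowerSterileCarrierAt.lean`: `Germ.exists_sterile_levelZeroDataAt_small R δ hδ : ∃ U, LevelZeroDataAt R U 7 ∧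
IsAxisymmetric U ∧ HasNoSwirl U ∧ … ∧ (eLpNorm U 3 volume).toReal ≤ δ`, at every `R`). [cite: Palasek2026ElementaryModel, §3.3] -/
theorem sterileSmallCarrierT : SterileSmallCarrierT := by
  intro δ hδ
  obtain ⟨U, hLZ, hax, hsw, -, -, -, -, hL3⟩ := Germ.exists_sterile_levelZeroDataAt_small TowerRates.tuned δ hδ
  exact ⟨U, hax, hsw, hLZ, hL3⟩

/-- **D2b — NO LONGER A STUB (v4): DISCHARGED BY NAME** by ecbridge-3 g12's landed theorem
`Theorems.palasekTowerBreakdown_sterileMechanismDoorT_of_sterileSmallCarrierT` (p562247: the door of record re-walked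
COAXIALLY — Kato tame run of the sterile `L³`-small carrier under the cap, `LevelZeroDataAt.exists_superposed_freeRun` at the
ON-AXIS translate `c = max r₀ 0 • e₃`, composite sterility, `LineGermDataAt.schedule_axisym_noSwirl`,
`LevelZeroDataAt.exists_lineGerm_stageOne_of_freeRun`). [cite: Palasek2026ElementaryModel, §4] [cite: Kato1984, Thm. 2–4] -/
theorem sterileMechanismDoorT_of_smallCarrierT : SterileSmallCarrierT → SterileMechanismDoorT :=
  fun h => Theorems.palasekTowerBreakdown_sterileMechanismDoorT_of_sterileSmallCarrierT h

/-! D2′ `GlobalDoorDesignT` is NOT a stub since v5: with D2 a theorem (below) the alternative road is no longer load-bearing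
for any conclusion of the line; it stays a named `Prop` taken as a hypothesis by `not_heredityPairT_of'` /
`door_mirror_decides'` (the symmetry-free GLOBAL-DESIGN road, of interest for the SHELF twins only). -/

/-! ## §3 Compositions (sorry-free) -/

/-- D2 = D2a + D2b. -/
theorem sterileMechanismDoorT_of (h₂a : SterileSmallCarrierT) (h₂b : SterileSmallCarrierT → SterileMechanismDoorT) :
    SterileMechanismDoorT :=
  h₂b h₂a

/-- T1′ + D2 ⟹ the swirl-free witness class at level `1` is inhabited. -/
theorem noSwirlRungAtOneT_of (h₁ : SterileDoorBoxT) (h₂ : SterileMechanismDoorT) : NoSwirlRungAtOneT := by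
  obtain ⟨W, ρ, v, q, η, hax, hns, hW, hdiv, hsupp, hlt, hρ, hv, hv1, hE, hη, hcap, hspeed, hstrain, hcore⟩ := h₁
  exact h₂ hax hns hW hdiv hsupp hlt hρ hv hv1 hE hη hcap hspeed hstrain hcore

/-- **THE CRUX OF RECORD through the sterile rung** (the registered composition: both stubs consumed):
`SterileDoorBoxT → SterileMechanismDoorT → EpisodeBaseT`. [cite: Palasek2026ElementaryModel, §4] -/
theorem EpisodeBaseT_of₂ (h₁ : SterileDoorBoxT) (h₂ : SterileMechanismDoorT) : PalasekTowerBreakdown.EpisodeBaseT := by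
  obtain ⟨S, hP, hR, hQ, -, hs⟩ := noSwirlRungAtOneT_of h₁ h₂
  exact ⟨S, hP, hR, hQ, hs⟩


/-- **THE COMPOSITION OF v3** (kept): T1′ + D2a + D2b ⟹ the crux of record, through the sterile rung.
[cite: Palasek2026ElementaryModel, §4] -/
theorem EpisodeBaseT_of (h₁ : SterileDoorBoxT) (h₂a : SterileSmallCarrierT)
    (h₂b : SterileSmallCarrierT → SterileMechanismDoorT) : PalasekTowerBreakdown.EpisodeBaseT :=
  EpisodeBaseT_of₂ h₁ (sterileMechanismDoorT_of h₂a h₂b)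

/-- **D2 FROM D2a ALONE (v4)**: the sterile mechanism door follows from sterile small carriers, D2b being a theorem. -/
theorem sterileMechanismDoorT_of_carrier (h₂a : SterileSmallCarrierT) : SterileMechanismDoorT :=
  sterileMechanismDoorT_of_smallCarrierT h₂a

/-- **D2 IS A THEOREM (v5)**: the mechanism door CAN be walked sterile at the tuned rates — by name over fc-prover-2's
sterile carrier (D2a) and ecbridge-3's coaxial door walk (D2b). [cite: Palasek2026ElementaryModel, §4] -/
theorem sterileMechanismDoorT : SterileMechanismDoorT :=
  sterileMechanismDoorT_of_smallCarrierT sterileSmallCarrierT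

/-- **THE REGISTERED COMPOSITION (v4)**: T1′ + D2a ⟹ the crux of record, through the sterile rung — the two open stubs
of the sterile road. [cite: Palasek2026ElementaryModel, §4] -/
theorem EpisodeBaseT_of_carrier (h₁ : SterileDoorBoxT) (h₂a : SterileSmallCarrierT) : PalasekTowerBreakdown.EpisodeBaseT :=
  EpisodeBaseT_of₂ h₁ (sterileMechanismDoorT_of_carrier h₂a)
/-- **THE CRUX OF RECORD FROM T1′ ALONE** — the landed door; sterility and D2 are NOT needed for 20303 itself.
[cite: Palasek2026ElementaryModel, §4] [cite: Tao2011, Thm. 5.4 (ii)+(iv)] -/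
theorem EpisodeBaseT_of₁ (h₁ : SterileDoorBoxT) : PalasekTowerBreakdown.EpisodeBaseT := by
  obtain ⟨W, ρ, v, q, η, -, -, hW, hdiv, hsupp, hlt, hρ, hv, hv1, hE, hη, hcap, hspeed, hstrain, hcore⟩ := h₁
  exact Theorems.palasekTowerBreakdown_episodeBaseT_of_mechanism_freeRun hW hdiv hsupp hlt hρ hv hv1 hE hη hcap hspeed hstrain
    hcore

/-- **THE NEGATION HALF** — T1′ + D2 refute the heredity PAIR of record (K201's forced swirl-free stratum by name:
`not_noSwirlRungAtOneT_of_heredity_pair`, global regularity `forcedNoSwirlGlobal_holds`).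
[cite: LemarieRieusset2016, Thm 10.4 (p. 285)] -/
theorem not_heredityPairT_of (h₁ : SterileDoorBoxT) (h₂ : SterileMechanismDoorT) :
    ¬ (PalasekTowerBreakdown.HeredityAtOneT ∧ PalasekTowerBreakdown.HeredityFromTwoT) :=
  fun h => not_noSwirlRungAtOneT_of_heredity_pair h.1 h.2 (noSwirlRungAtOneT_of h₁ h₂)

/-- **THE DOOR-MIRROR DECIDER** — from T1′ and D2: the base of record holds and the heredity pair of record is refuted;
i.e. the #64 (4) fork is decided in the door reading by ONE sterile 2-D certificate plus ONE kernel lemma.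
[cite: Palasek2026ElementaryModel, §4] [cite: LemarieRieusset2016, Thm 10.4 (p. 285)] -/
theorem door_mirror_decides (h₁ : SterileDoorBoxT) (h₂ : SterileMechanismDoorT) :
    PalasekTowerBreakdown.EpisodeBaseT ∧
      ¬ (PalasekTowerBreakdown.HeredityAtOneT ∧ PalasekTowerBreakdown.HeredityFromTwoT) :=
  ⟨EpisodeBaseT_of₁ h₁, not_heredityPairT_of h₁ h₂⟩

/-- **THE NEGATION HALF, ALTERNATIVE ROAD** — T1′ + D2′ refute the heredity PAIR of record by K201's cap-free,
symmetry-free GLOBAL-DESIGN LEVER (`HeredityFromGAt.false_of_global_classical`): the pair extends the design's level-`1`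
stage to level `2` (`HeredityAtOneT`) and then to every level (`HeredityFromTwoT`), against the global classical solution.
[cite: Tao2011, Cor. 11.4] -/
theorem not_heredityPairT_of' (h₁ : SterileDoorBoxT) (h₂ : GlobalDoorDesignT) :
    ¬ (PalasekTowerBreakdown.HeredityAtOneT ∧ PalasekTowerBreakdown.HeredityFromTwoT) := by
  rintro ⟨hA, hF⟩
  obtain ⟨W, ρ, v, q, η, hax, hns, hW, hdiv, hsupp, hlt, hρ, hv, hv1, hE, hη, hcap, hspeed, hstrain, hcore⟩ := h₁
  obtain ⟨S, s, u, p, hP, hR, hQ, hcl, h0, hBE⟩ :=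
    h₂ hax hns hW hdiv hsupp hlt hρ hv hv1 hE hη hcap hspeed hstrain hcore
  obtain ⟨s₂, -⟩ := hA S hP hR hQ s
  exact HeredityFromGAt.false_of_global_classical hF hP hR hQ s₂ hcl h0 hBE

/-- The crux of record from T1′ + D2′ as well (the design of D2′ is registered; or simply `EpisodeBaseT_of₁`). -/
theorem EpisodeBaseT_of' (h₁ : SterileDoorBoxT) (h₂ : GlobalDoorDesignT) : PalasekTowerBreakdown.EpisodeBaseT := by
  obtain ⟨W, ρ, v, q, η, hax, hns, hW, hdiv, hsupp, hlt, hρ, hv, hv1, hE, hη, hcap, hspeed, hstrain, hcore⟩ := h₁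
  obtain ⟨S, s, -, -, hP, hR, hQ, -⟩ := h₂ hax hns hW hdiv hsupp hlt hρ hv hv1 hE hη hcap hspeed hstrain hcore
  exact ⟨S, hP, hR, hQ, ⟨s⟩⟩

/-- **THE DOOR-MIRROR DECIDER, ALTERNATIVE ROAD** (T1′ + D2′). [cite: Tao2011, Cor. 11.4] -/
theorem door_mirror_decides' (h₁ : SterileDoorBoxT) (h₂ : GlobalDoorDesignT) :
    PalasekTowerBreakdown.EpisodeBaseT ∧
      ¬ (PalasekTowerBreakdown.HeredityAtOneT ∧ PalasekTowerBreakdown.HeredityFromTwoT) :=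
  ⟨EpisodeBaseT_of₁ h₁, not_heredityPairT_of' h₁ h₂⟩

/-- One of the two heredity items fails (which one is not decided without a quantitative cap — K201). -/
theorem heredityAtOneT_false_or_heredityFromTwoT_false (h₁ : SterileDoorBoxT) (h₂ : SterileMechanismDoorT) :
    ¬ PalasekTowerBreakdown.HeredityAtOneT ∨ ¬ PalasekTowerBreakdown.HeredityFromTwoT :=
  HeredityAtOneT_false_or_HeredityFromTwoT_false_of_noSwirlRungAtOneT (noSwirlRungAtOneT_of h₁ h₂)

/-- **WHAT A STERILE DOOR CERTIFICATE PLUS THE STERILE CARRIER DECIDES (v4)**: T1′ + D2a ⟹ the crux of record holds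
AND the heredity pair of record fails — the PLAIN door box decides the pair once D2a lands.
[cite: Palasek2026ElementaryModel, §4] -/
theorem door_mirror_decides_of_carrier (h₁ : SterileDoorBoxT) (h₂a : SterileSmallCarrierT) :
    PalasekTowerBreakdown.EpisodeBaseT ∧
      ¬ (PalasekTowerBreakdown.HeredityAtOneT ∧ PalasekTowerBreakdown.HeredityFromTwoT) :=
  door_mirror_decides h₁ (sterileMechanismDoorT_of_carrier h₂a)

/-! ## §4 The sterile road with ONE open stub (v5) -/

/-- **T1′ ALONE ⟹ the swirl-free witness class at level `1` is inhabited** (D2 is a theorem). -/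
theorem noSwirlRungAtOneT_of₁ (h₁ : SterileDoorBoxT) : NoSwirlRungAtOneT :=
  noSwirlRungAtOneT_of h₁ sterileMechanismDoorT

/-- **T1′ ALONE refutes the heredity PAIR of record** (K201's forced swirl-free stratum; D2 is a theorem).
[cite: Palasek2026ElementaryModel, §4] -/
theorem not_heredityPairT_of₁ (h₁ : SterileDoorBoxT) :
    ¬ (PalasekTowerBreakdown.HeredityAtOneT ∧ PalasekTowerBreakdown.HeredityFromTwoT) :=
  not_heredityPairT_of h₁ sterileMechanismDoorT

/-- **WHAT A STERILE DOOR CERTIFICATE ALONE DECIDES (v5)**: some axisymmetric swirl-free `W` meeting the PLAIN door box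
(READING 2) ⟹ the crux of record `EpisodeBaseT` holds AND the heredity pair `HeredityAtOneT ∧ HeredityFromTwoT` of the
route's deciding theorem fails — by name over the landed door (p540639), the coaxial door walk (p562247) and the sterile
strict-slot carrier (fc-prover-2 g11). [cite: Palasek2026ElementaryModel, §4] [cite: Tao2011, Thm. 5.4 (ii)+(iv)] -/
theorem door_mirror_decides₁ (h₁ : SterileDoorBoxT) :
    PalasekTowerBreakdown.EpisodeBaseT ∧
      ¬ (PalasekTowerBreakdown.HeredityAtOneT ∧ PalasekTowerBreakdown.HeredityFromTwoT) :=
  door_mirror_decides h₁ sterileMechanismDoorT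

/-- One of the two heredity items fails, from T1′ alone. -/
theorem heredityAtOneT_false_or_heredityFromTwoT_false₁ (h₁ : SterileDoorBoxT) :
    ¬ PalasekTowerBreakdown.HeredityAtOneT ∨ ¬ PalasekTowerBreakdown.HeredityFromTwoT :=
  heredityAtOneT_false_or_heredityFromTwoT_false h₁ sterileMechanismDoorT

/-- From the open stub: the line's content in one term (std axioms + the ONE `sorry` of T1′). -/
theorem door_mirror_decides_from_stub :
    PalasekTowerBreakdown.EpisodeBaseT ∧
      ¬ (PalasekTowerBreakdown.HeredityAtOneT ∧ PalasekTowerBreakdown.HeredityFromTwoT) :=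
  door_mirror_decides₁ stub_sterile_doorboxT

end Summit.NavierStokesRegularity.NavierStokesRegularity.Cruxes.EpisodeBaseT.DoorMirror

end
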